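import Mathlib
import HarnessLib

/-!
# Convexity of mean squares on vertical lines (Hardy–Ingham–Pólya / Gabriel, one variable)

Topic `Literature/Analysis/Complex`. Everything in this file is PROVED (no definitions, no named
facts).

Let `G` be holomorphic on a vertical strip slightly wider than `l ≤ Re s ≤ u` and dominated there
by a Gaussian in `Im s`: `‖G(s)‖ ≤ M e^{-(Im s − T₀)²/V²}`. Then the mean squares
`J(σ) = ∫_{-∞}^{∞} |G(σ+it)|² dt` satisfy the **three-lines inequality**

  `J(σ) ≤ J(l)^{1−θ} J(u)^θ`, `θ = (σ − l)/(u − l)`,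

i.e. `log J` is convex (Hardy–Ingham–Pólya 1927; the one-variable case of Gabriel's theorem,
Titchmarsh §7.8 and §9.19). Proof: the function `Φ(s) = ∫ G(s+iy) conj(G(conj(s)+iy)) dy` is
holomorphic in the strip (differentiation under the integral sign, Cauchy's estimate for `G'`),
bounded, equals `J(σ)` for real `s = σ`, and on the line `Re s = l` is at most `J(l)` by
`2|ab| ≤ |a|² + |b|²` and translation invariance; Hadamard's three-lines theorem
(`Complex.HadamardThreeLines.norm_le_interp_of_mem_verticalClosedStrip'`) concludes.

This is the convexity step of Selberg's density theorem / Titchmarsh §9.24 (applied to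
`G = (ζψ − 1) ×` a Gaussian-type kernel).

* `Literature.Analysis.Complex.meanSquare_le_interp` — the statement above.

## References

* G. H. Hardy, A. E. Ingham, G. Pólya, *Theorems concerning mean values of analytic functions*,
  Proc. Royal Soc. A 113 (1927) 542–569.
* E. C. Titchmarsh, *The Theory of the Riemann Zeta-Function*, 2nd ed. (1986), §7.8, §9.19.
  [cite: Titchmarsh1986, §7.8]
-/

noncomputable section

open Complex MeasureTheory Set Filter Metric Real
open scoped ComplexConjugate Topology
open Complex.HadamardThreeLines (verticalStrip verticalClosedStrip)

namespace Literature.Analysis.Complex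

/-! ### Gaussian majorants -/

/-- `(a + e)² ≥ a²/2 − e²`. [folklore] -/
theorem half_sq_sub_sq_le_sq_add (a e : ℝ) : a ^ 2 / 2 - e ^ 2 ≤ (a + e) ^ 2 := by
  nlinarith [sq_nonneg (a / 2 + e), sq_nonneg (a + 2 * e)]

/-- Shifting a Gaussian: if `|v' − v| ≤ ρ` then `e^{-(v'−c)²/k} ≤ e^{ρ²/k} e^{-(v−c)²/(2k)}` (`k > 0`).
[folklore] -/
theorem exp_neg_sq_shift_le {v v' c k ρ : ℝ} (hk : 0 < k) (h : |v' - v| ≤ ρ) :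
    Real.exp (-(v' - c) ^ 2 / k) ≤ Real.exp (ρ ^ 2 / k) * Real.exp (-(v - c) ^ 2 / (2 * k)) := by
  rw [← Real.exp_add]
  refine Real.exp_le_exp.2 ?_
  have h1 := half_sq_sub_sq_le_sq_add (v - c) (v' - v)
  have h2 : (v' - v) ^ 2 ≤ ρ ^ 2 := by
    have := abs_le.1 h; nlinarith
  have e : v - c + (v' - v) = v' - c := by ring
  rw [e] at h1
  have key : -(v' - c) ^ 2 ≤ ρ ^ 2 - (v - c) ^ 2 / 2 := by linarith
  have e1 : ρ ^ 2 / k + -(v - c) ^ 2 / (2 * k) = (ρ ^ 2 - (v - c) ^ 2 / 2) / k := by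
    field_simp; ring
  rw [e1]
  exact div_le_div_of_nonneg_right key hk.le

/-- Integrability of a shifted Gaussian `v ↦ e^{-(v − c)²/k}`, `k > 0`. [folklore] -/
theorem integrable_exp_neg_sq_div {c k : ℝ} (hk : 0 < k) :
    Integrable fun v : ℝ => Real.exp (-(v - c) ^ 2 / k) := by
  have h := (integrable_exp_neg_mul_sq (inv_pos.2 hk)).comp_sub_right c
  refine h.congr (ae_of_all _ fun v => ?_)
  field_simp

/-- `∫ e^{-(v−c)²/k} dv = √(πk)`. [folklore] -/
theorem integral_exp_neg_sq_div {c k : ℝ} (hk : 0 < k) :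
    ∫ v : ℝ, Real.exp (-(v - c) ^ 2 / k) = Real.sqrt (π * k) := by
  have h := integral_sub_right_eq_self (μ := volume) (fun v : ℝ => Real.exp (-k⁻¹ * v ^ 2)) c
  rw [show (fun v : ℝ => Real.exp (-(v - c) ^ 2 / k)) = fun v => Real.exp (-k⁻¹ * (v - c) ^ 2) by
    funext v; congr 1; field_simp, h, integral_gaussian]
  congr 1; field_simp

/-! ### The setting: `G` holomorphic on a wider strip with a Gaussian majorant -/

section Setting

variable {G : ℂ → ℂ} {l u δ M V T₀ : ℝ}

/-- Membership in strips from real-part inequalities. [folklore] -/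
theorem mem_verticalClosedStrip_iff {a b : ℝ} {z : ℂ} :
    z ∈ verticalClosedStrip a b ↔ a ≤ z.re ∧ z.re ≤ b := by
  simp [verticalClosedStrip, Set.mem_Icc]

/-- Membership in open strips. [folklore] -/
theorem mem_verticalStrip_iff {a b : ℝ} {z : ℂ} :
    z ∈ verticalStrip a b ↔ a < z.re ∧ z.re < b := by
  simp [verticalStrip, Set.mem_Ioo]

/-- The open strip is open. [folklore] -/
theorem isOpen_verticalStrip (a b : ℝ) : IsOpen (verticalStrip a b) :=
  isOpen_Ioo.preimage Complex.continuous_re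

/-- **`G` near a point of the strip `[l − δ/2, u + δ/2]`**: if `‖w − z‖ ≤ δ/2` then `w` lies in the
closed strip `[l − δ, u + δ]` and `‖G w‖ ≤ M e^{δ²/(4V²)} e^{-(Im z − T₀)²/(2V²)}`. [folklore] -/
theorem norm_le_near {z w : ℂ} (hV : 0 < V)
    (hB : ∀ z ∈ verticalClosedStrip (l - δ) (u + δ), ‖G z‖ ≤ M * Real.exp (-(z.im - T₀) ^ 2 / V ^ 2))
    (hz : z ∈ verticalClosedStrip (l - δ / 2) (u + δ / 2)) (hw : ‖w - z‖ ≤ δ / 2) (hM : 0 ≤ M) :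
    ‖G w‖ ≤ M * Real.exp (δ ^ 2 / (4 * V ^ 2)) * Real.exp (-(z.im - T₀) ^ 2 / (2 * V ^ 2)) := by
  have hre : |w.re - z.re| ≤ δ / 2 := by
    have := abs_re_le_norm (w - z); rw [sub_re] at this; exact this.trans hw
  have him : |w.im - z.im| ≤ δ / 2 := by
    have := abs_im_le_norm (w - z); rw [sub_im] at this; exact this.trans hw
  obtain ⟨hz1, hz2⟩ := mem_verticalClosedStrip_iff.1 hz
  have hwmem : w ∈ verticalClosedStrip (l - δ) (u + δ) := by
    rw [mem_verticalClosedStrip_iff]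
    have := abs_le.1 hre
    constructor <;> linarith
  have h1 := hB w hwmem
  have h2 := exp_neg_sq_shift_le (c := T₀) (k := V ^ 2) (by positivity) him
  have e : (δ / 2) ^ 2 / V ^ 2 = δ ^ 2 / (4 * V ^ 2) := by ring
  rw [e] at h2
  calc ‖G w‖ ≤ M * Real.exp (-(w.im - T₀) ^ 2 / V ^ 2) := h1
    _ ≤ M * (Real.exp (δ ^ 2 / (4 * V ^ 2)) * Real.exp (-(z.im - T₀) ^ 2 / (2 * V ^ 2))) :=
        mul_le_mul_of_nonneg_left h2 hM
    _ = _ := by ring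

/-- **Cauchy's estimate for `G'`** on the closed strip `[l − δ/2, u + δ/2]`:
`‖G'(z)‖ ≤ (4M e^{δ²/(4V²)}/δ) e^{-(Im z − T₀)²/(2V²)}`. [folklore] -/
theorem norm_deriv_le_of_mem_strip {z : ℂ} (hδ : 0 < δ) (hV : 0 < V) (hM : 0 ≤ M)
    (hG : DifferentiableOn ℂ G (verticalStrip (l - δ) (u + δ)))
    (hB : ∀ z ∈ verticalClosedStrip (l - δ) (u + δ), ‖G z‖ ≤ M * Real.exp (-(z.im - T₀) ^ 2 / V ^ 2))
    (hz : z ∈ verticalClosedStrip (l - δ / 2) (u + δ / 2)) :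
    ‖deriv G z‖ ≤ 4 * M * Real.exp (δ ^ 2 / (4 * V ^ 2)) / δ * Real.exp (-(z.im - T₀) ^ 2 / (2 * V ^ 2)) := by
  obtain ⟨hz1, hz2⟩ := mem_verticalClosedStrip_iff.1 hz
  have hR : 0 < δ / 4 := by positivity
  -- the closed ball of radius `δ/4` lies in the open strip
  have hball : closedBall z (δ / 4) ⊆ verticalStrip (l - δ) (u + δ) := by
    intro w hw
    rw [mem_closedBall, dist_eq_norm] at hw
    have hre : |w.re - z.re| ≤ δ / 4 := by
      have := abs_re_le_norm (w - z); rw [sub_re] at this; exact this.trans hw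
    rw [mem_verticalStrip_iff]
    have := abs_le.1 hre
    constructor <;> linarith
  have hd : DiffContOnCl ℂ G (ball z (δ / 4)) := hG.diffContOnCl_ball hball
  have hC : ∀ w ∈ sphere z (δ / 4), ‖G w‖ ≤
      M * Real.exp (δ ^ 2 / (4 * V ^ 2)) * Real.exp (-(z.im - T₀) ^ 2 / (2 * V ^ 2)) := by
    intro w hw
    refine norm_le_near hV hB hz ?_ hM
    rw [mem_sphere, dist_eq_norm] at hw
    linarith
  have h := Complex.norm_deriv_le_of_forall_mem_sphere_norm_le hR hd hC
  refine h.trans (le_of_eq ?_)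
  field_simp

end Setting

/-! ### The analytic family `F(s, y) = G(s+iy) conj(G(conj(s)+iy))` -/

section Family

variable {G : ℂ → ℂ} {l u δ M V T₀ : ℝ}

/-- Points `s + iy`, `conj(s) + iy` for `Re s` in an interval lie in the corresponding strip. [folklore] -/
theorem add_mul_I_mem_verticalStrip {a b : ℝ} {s : ℂ} (hs : a < s.re ∧ s.re < b) (y : ℝ) :
    s + y * I ∈ verticalStrip a b ∧ conj s + y * I ∈ verticalStrip a b := by
  constructor <;> rw [mem_verticalStrip_iff] <;> simpa using hs

/-- **Derivative of `s ↦ G(s+iy) conj(G(conj(s)+iy))`.** [folklore] -/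
theorem hasDerivAt_family (hG : DifferentiableOn ℂ G (verticalStrip (l - δ) (u + δ))) (y : ℝ) {s : ℂ}
    (hs : l - δ < s.re ∧ s.re < u + δ) :
    HasDerivAt (fun s : ℂ => G (s + y * I) * conj (G (conj s + y * I)))
      (deriv G (s + y * I) * conj (G (conj s + y * I)) + G (s + y * I) * conj (deriv G (conj s + y * I))) s := by
  obtain ⟨h1mem, h2mem⟩ := add_mul_I_mem_verticalStrip hs y
  have hopen := isOpen_verticalStrip (l - δ) (u + δ)
  have hd1 : HasDerivAt G (deriv G (s + y * I)) (s + y * I) :=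
    (hG.differentiableAt (hopen.mem_nhds h1mem)).hasDerivAt
  have hd2 : HasDerivAt G (deriv G (conj s + y * I)) (conj s + y * I) :=
    (hG.differentiableAt (hopen.mem_nhds h2mem)).hasDerivAt
  have h1 : HasDerivAt (fun s : ℂ => G (s + y * I)) (deriv G (s + y * I)) s :=
    hd1.comp_add_const s (y * I)
  have h2' : HasDerivAt (fun w : ℂ => G (w + y * I)) (deriv G (conj s + y * I)) (conj s) :=
    hd2.comp_add_const (conj s) (y * I)
  have h2 : HasDerivAt (fun s : ℂ => conj (G (conj s + y * I))) (conj (deriv G (conj s + y * I))) s := by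
    have := h2'.conj_conj
    rw [Complex.conj_conj] at this
    exact this
  exact h1.mul h2

/-- Continuity of `y ↦ G(s+iy)` when `Re s` is inside the strip. [folklore] -/
theorem continuous_G_vertical (hG : DifferentiableOn ℂ G (verticalStrip (l - δ) (u + δ))) {s : ℂ}
    (hs : l - δ < s.re ∧ s.re < u + δ) : Continuous fun y : ℝ => G (s + y * I) := by
  refine hG.continuousOn.comp_continuous (continuous_const.add (Complex.continuous_ofReal.mul continuous_const))
    fun y => (add_mul_I_mem_verticalStrip hs y).1

/-- Continuity of `y ↦ G'(s+iy)` when `Re s` is inside the strip. [folklore] -/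
theorem continuous_derivG_vertical (hG : DifferentiableOn ℂ G (verticalStrip (l - δ) (u + δ))) {s : ℂ}
    (hs : l - δ < s.re ∧ s.re < u + δ) : Continuous fun y : ℝ => deriv G (s + y * I) := by
  refine (hG.deriv (isOpen_verticalStrip _ _)).continuousOn.comp_continuous
    (continuous_const.add (Complex.continuous_ofReal.mul continuous_const))
    fun y => (add_mul_I_mem_verticalStrip hs y).1

/-- Continuity of `y ↦ F(s, y)`. [folklore] -/
theorem continuous_family (hG : DifferentiableOn ℂ G (verticalStrip (l - δ) (u + δ))) {s : ℂ}
    (hs : l - δ < s.re ∧ s.re < u + δ) :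
    Continuous fun y : ℝ => G (s + y * I) * conj (G (conj s + y * I)) := by
  have hs' : l - δ < (conj s).re ∧ (conj s).re < u + δ := by simpa using hs
  exact (continuous_G_vertical hG hs).mul (Complex.continuous_conj.comp (continuous_G_vertical hG hs'))

/-- The Gaussian majorant of the family: for `s` in the closed strip `[l − δ, u + δ]`,
`‖F(s, y)‖ ≤ M² e^{-(y + Im s − T₀)²/V²}`. [folklore] -/
theorem norm_family_le (hM : 0 ≤ M)
    (hB : ∀ z ∈ verticalClosedStrip (l - δ) (u + δ), ‖G z‖ ≤ M * Real.exp (-(z.im - T₀) ^ 2 / V ^ 2))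
    {s : ℂ} (hs : s ∈ verticalClosedStrip (l - δ) (u + δ)) (y : ℝ) :
    ‖G (s + y * I) * conj (G (conj s + y * I))‖ ≤ M ^ 2 * Real.exp (-(y - (T₀ - s.im)) ^ 2 / V ^ 2) := by
  obtain ⟨hs1, hs2⟩ := mem_verticalClosedStrip_iff.1 hs
  have hmem1 : s + y * I ∈ verticalClosedStrip (l - δ) (u + δ) := by
    rw [mem_verticalClosedStrip_iff]; simpa using And.intro hs1 hs2
  have hmem2 : conj s + y * I ∈ verticalClosedStrip (l - δ) (u + δ) := by
    rw [mem_verticalClosedStrip_iff]; simpa using And.intro hs1 hs2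
  have h1 := hB _ hmem1
  have h2 := hB _ hmem2
  have hexp2 : Real.exp (-((conj s + y * I).im - T₀) ^ 2 / V ^ 2) ≤ 1 := by
    rw [Real.exp_le_one_iff, neg_div]; exact neg_nonpos.2 (by positivity)
  have him : (s + y * I).im = y + s.im := by simp; ring
  rw [norm_mul, Complex.norm_conj]
  calc ‖G (s + y * I)‖ * ‖G (conj s + y * I)‖
      ≤ (M * Real.exp (-((s + y * I).im - T₀) ^ 2 / V ^ 2)) * (M * 1) := by
        refine mul_le_mul h1 (h2.trans ?_) (norm_nonneg _) (by positivity)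
        exact mul_le_mul_of_nonneg_left hexp2 hM
    _ = M ^ 2 * Real.exp (-(y - (T₀ - s.im)) ^ 2 / V ^ 2) := by
        rw [him, show y + s.im - T₀ = y - (T₀ - s.im) by ring]; ring

/-- **Holomorphy of `Φ(s) = ∫ F(s,y) dy`** on the open strip `(l, u)` (differentiation under the
integral sign). [folklore] -/
theorem differentiableOn_Phi (hδ : 0 < δ) (hV : 0 < V) (hM : 0 ≤ M)
    (hG : DifferentiableOn ℂ G (verticalStrip (l - δ) (u + δ)))
    (hB : ∀ z ∈ verticalClosedStrip (l - δ) (u + δ), ‖G z‖ ≤ M * Real.exp (-(z.im - T₀) ^ 2 / V ^ 2)) :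
    DifferentiableOn ℂ (fun s : ℂ => ∫ y : ℝ, G (s + y * I) * conj (G (conj s + y * I)))
      (verticalStrip l u) := by
  intro s₀ hs₀
  obtain ⟨hs₀1, hs₀2⟩ := mem_verticalStrip_iff.1 hs₀
  -- constants
  set M₁ := 4 * M * Real.exp (δ ^ 2 / (4 * V ^ 2)) / δ with hM₁
  have hM₁0 : 0 ≤ M₁ := by positivity
  set eS := Real.exp ((δ / 4) ^ 2 / (2 * V ^ 2)) with heS
  set F' : ℂ → ℝ → ℂ := fun s y =>
    deriv G (s + y * I) * conj (G (conj s + y * I)) + G (s + y * I) * conj (deriv G (conj s + y * I)) with hF'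
  set bound : ℝ → ℝ := fun y => M * M₁ * eS *
    (Real.exp (-(y - (T₀ - s₀.im)) ^ 2 / (2 * (2 * V ^ 2))) + Real.exp (-(y - (T₀ + s₀.im)) ^ 2 / (2 * (2 * V ^ 2))))
    with hbound
  have hball_re : ∀ s ∈ ball s₀ (δ / 4), l - δ / 4 < s.re ∧ s.re < u + δ / 4 ∧ |s.im - s₀.im| < δ / 4 := by
    intro s hs
    rw [mem_ball, dist_eq_norm] at hs
    have hre : |s.re - s₀.re| < δ / 4 := lt_of_le_of_lt (by simpa using abs_re_le_norm (s - s₀)) hs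
    have him : |s.im - s₀.im| < δ / 4 := lt_of_le_of_lt (by simpa using abs_im_le_norm (s - s₀)) hs
    have := abs_lt.1 hre
    exact ⟨by linarith, by linarith, him⟩
  have hwide : ∀ s ∈ ball s₀ (δ / 4), l - δ < s.re ∧ s.re < u + δ := fun s hs => by
    obtain ⟨h1, h2, -⟩ := hball_re s hs; exact ⟨by linarith, by linarith⟩
  have key := hasDerivAt_integral_of_dominated_loc_of_deriv_le (μ := volume) (𝕜 := ℂ)
    (F := fun s y => G (s + y * I) * conj (G (conj s + y * I))) (F' := F') (x₀ := s₀)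
    (s := ball s₀ (δ / 4)) (bound := bound) (ball_mem_nhds s₀ (by positivity)) ?_ ?_ ?_ ?_ ?_ ?_
  · exact key.2.differentiableAt.differentiableWithinAt
  · -- measurability near `s₀`
    filter_upwards [ball_mem_nhds s₀ (show (0 : ℝ) < δ / 4 by positivity)] with s hs
    exact (continuous_family hG (hwide s hs)).aestronglyMeasurable
  · -- integrability at `s₀`
    have hs₀mem : s₀ ∈ verticalClosedStrip (l - δ) (u + δ) := by
      rw [mem_verticalClosedStrip_iff]; constructor <;> linarith
    refine Integrable.mono' ((integrable_exp_neg_sq_div (c := T₀ - s₀.im) (by positivity : (0:ℝ) < V ^ 2)).const_mul (M ^ 2))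
      (continuous_family hG (hwide s₀ (mem_ball_self (by positivity)))).aestronglyMeasurable
      (ae_of_all _ fun y => ?_)
    exact norm_family_le hM hB hs₀mem y
  · exact ((continuous_derivG_vertical hG (hwide s₀ (mem_ball_self (by positivity)))).mul
      (Complex.continuous_conj.comp (continuous_G_vertical hG (by simpa using hwide s₀ (mem_ball_self (by positivity)))))
      |>.add ((continuous_G_vertical hG (hwide s₀ (mem_ball_self (by positivity)))).mul
        (Complex.continuous_conj.comp (continuous_derivG_vertical hG (by simpa using hwide s₀ (mem_ball_self (by positivity))))))).aestronglyMeasurable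
  · -- the derivative bound on the ball
    refine ae_of_all _ fun y s hs => ?_
    obtain ⟨hre1, hre2, him⟩ := hball_re s hs
    have hsc : s + y * I ∈ verticalClosedStrip (l - δ / 2) (u + δ / 2) := by
      rw [mem_verticalClosedStrip_iff]; simp; constructor <;> linarith
    have hsc' : conj s + y * I ∈ verticalClosedStrip (l - δ / 2) (u + δ / 2) := by
      rw [mem_verticalClosedStrip_iff]; simp; constructor <;> linarith
    have hsw : s + y * I ∈ verticalClosedStrip (l - δ) (u + δ) := by
      rw [mem_verticalClosedStrip_iff]; simp; constructor <;> linarith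
    have hsw' : conj s + y * I ∈ verticalClosedStrip (l - δ) (u + δ) := by
      rw [mem_verticalClosedStrip_iff]; simp; constructor <;> linarith
    have hd1 := norm_deriv_le_of_mem_strip hδ hV hM hG hB hsc
    have hd2 := norm_deriv_le_of_mem_strip hδ hV hM hG hB hsc'
    have hg1 := hB _ hsw
    have hg2 := hB _ hsw'
    rw [← hM₁] at hd1 hd2
    have him1 : (s + y * I).im = y + s.im := by simp; ring
    have him2 : (conj s + y * I).im = y - s.im := by simp; ring
    rw [him1] at hd1 hg1
    rw [him2] at hd2 hg2
    -- Gaussians ≤ 1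
    have hle1 : Real.exp (-(y + s.im - T₀) ^ 2 / V ^ 2) ≤ 1 := by
      rw [Real.exp_le_one_iff, neg_div]; exact neg_nonpos.2 (by positivity)
    have hle2 : Real.exp (-(y - s.im - T₀) ^ 2 / V ^ 2) ≤ 1 := by
      rw [Real.exp_le_one_iff, neg_div]; exact neg_nonpos.2 (by positivity)
    -- shift the two derivative Gaussians to `s₀`
    have hk : (0 : ℝ) < 2 * V ^ 2 := by positivity
    have hsh1 : Real.exp (-(y + s.im - T₀) ^ 2 / (2 * V ^ 2)) ≤
        eS * Real.exp (-(y - (T₀ - s₀.im)) ^ 2 / (2 * (2 * V ^ 2))) := by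
      have h := exp_neg_sq_shift_le (v' := y + s.im) (v := y + s₀.im) (c := T₀) (k := 2 * V ^ 2)
        (ρ := δ / 4) hk (by rw [show y + s.im - (y + s₀.im) = s.im - s₀.im by ring]; exact him.le)
      rw [heS]; convert h using 2; ring_nf
    have hsh2 : Real.exp (-(y - s.im - T₀) ^ 2 / (2 * V ^ 2)) ≤
        eS * Real.exp (-(y - (T₀ + s₀.im)) ^ 2 / (2 * (2 * V ^ 2))) := by
      have h := exp_neg_sq_shift_le (v' := y - s.im) (v := y - s₀.im) (c := T₀) (k := 2 * V ^ 2)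
        (ρ := δ / 4) hk (by
          rw [show y - s.im - (y - s₀.im) = -(s.im - s₀.im) by ring, abs_neg]; exact him.le)
      rw [heS]; convert h using 2; ring_nf
    -- combine
    have hA : ‖deriv G (s + y * I) * conj (G (conj s + y * I))‖ ≤
        M * M₁ * eS * Real.exp (-(y - (T₀ - s₀.im)) ^ 2 / (2 * (2 * V ^ 2))) := by
      rw [norm_mul, Complex.norm_conj]
      calc ‖deriv G (s + y * I)‖ * ‖G (conj s + y * I)‖
          ≤ (M₁ * Real.exp (-(y + s.im - T₀) ^ 2 / (2 * V ^ 2))) * (M * 1) := by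
            refine mul_le_mul hd1 (hg2.trans (mul_le_mul_of_nonneg_left hle2 hM)) (norm_nonneg _) (by positivity)
        _ ≤ (M₁ * (eS * Real.exp (-(y - (T₀ - s₀.im)) ^ 2 / (2 * (2 * V ^ 2))))) * (M * 1) := by
            gcongr
        _ = _ := by ring
    have hB' : ‖G (s + y * I) * conj (deriv G (conj s + y * I))‖ ≤
        M * M₁ * eS * Real.exp (-(y - (T₀ + s₀.im)) ^ 2 / (2 * (2 * V ^ 2))) := by
      rw [norm_mul, Complex.norm_conj]
      calc ‖G (s + y * I)‖ * ‖deriv G (conj s + y * I)‖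
          ≤ (M * 1) * (M₁ * Real.exp (-(y - s.im - T₀) ^ 2 / (2 * V ^ 2))) := by
            refine mul_le_mul (hg1.trans (mul_le_mul_of_nonneg_left hle1 hM)) hd2 (norm_nonneg _) (by positivity)
        _ ≤ (M * 1) * (M₁ * (eS * Real.exp (-(y - (T₀ + s₀.im)) ^ 2 / (2 * (2 * V ^ 2))))) := by
            gcongr
        _ = _ := by ring
    calc ‖F' s y‖ ≤ ‖deriv G (s + y * I) * conj (G (conj s + y * I))‖
          + ‖G (s + y * I) * conj (deriv G (conj s + y * I))‖ := norm_add_le _ _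
      _ ≤ _ := by rw [hbound]; linarith
  · -- integrability of the bound
    exact ((integrable_exp_neg_sq_div (c := T₀ - s₀.im) (by positivity)).add
      (integrable_exp_neg_sq_div (c := T₀ + s₀.im) (by positivity))).const_mul _
  · -- differentiability on the ball
    exact ae_of_all _ fun y s hs => hasDerivAt_family hG y (hwide s hs)

end Family

/-! ### Continuity, bounds, edge values of `Φ` -/

section Phi

variable {G : ℂ → ℂ} {l u δ M V T₀ : ℝ}

/-- **Continuity of `Φ` on the closed strip `[l, u]`** (dominated convergence, locally in `Im s`).
[folklore] -/
theorem continuousOn_Phi (hδ : 0 < δ) (hV : 0 < V) (hM : 0 ≤ M)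
    (hG : DifferentiableOn ℂ G (verticalStrip (l - δ) (u + δ)))
    (hB : ∀ z ∈ verticalClosedStrip (l - δ) (u + δ), ‖G z‖ ≤ M * Real.exp (-(z.im - T₀) ^ 2 / V ^ 2)) :
    ContinuousOn (fun s : ℂ => ∫ y : ℝ, G (s + y * I) * conj (G (conj s + y * I)))
      (verticalClosedStrip l u) := by
  intro s₀ hs₀
  obtain ⟨hs₀1, hs₀2⟩ := mem_verticalClosedStrip_iff.1 hs₀
  -- continuity on the piece `strip ∩ closedBall s₀ 1`
  set S := verticalClosedStrip l u ∩ closedBall s₀ 1 with hS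
  have hpiece : ContinuousOn (fun s : ℂ => ∫ y : ℝ, G (s + y * I) * conj (G (conj s + y * I))) S := by
    have hwide : ∀ s ∈ S, l - δ < s.re ∧ s.re < u + δ := by
      intro s hs
      obtain ⟨h1, h2⟩ := mem_verticalClosedStrip_iff.1 hs.1
      exact ⟨by linarith, by linarith⟩
    refine continuousOn_of_dominated (bound := fun y => M ^ 2 * (Real.exp (1 ^ 2 / V ^ 2) *
        Real.exp (-(y - (T₀ - s₀.im)) ^ 2 / (2 * V ^ 2)))) ?_ ?_ ?_ ?_
    · exact fun s hs => (continuous_family hG (hwide s hs)).aestronglyMeasurable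
    · intro s hs
      refine ae_of_all _ fun y => ?_
      have hsmem : s ∈ verticalClosedStrip (l - δ) (u + δ) := by
        rw [mem_verticalClosedStrip_iff]; obtain ⟨h1, h2⟩ := hwide s hs; constructor <;> linarith
      refine (norm_family_le hM hB hsmem y).trans ?_
      refine mul_le_mul_of_nonneg_left ?_ (by positivity)
      have him : |s.im - s₀.im| ≤ 1 := by
        have h2 : s ∈ closedBall s₀ 1 := hs.2
        rw [mem_closedBall, dist_eq_norm] at h2
        have him0 : |s.im - s₀.im| ≤ ‖s - s₀‖ := by simpa using abs_im_le_norm (s - s₀)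
        exact him0.trans h2
      have h := exp_neg_sq_shift_le (v' := y + s.im) (v := y + s₀.im) (c := T₀) (k := V ^ 2) (ρ := 1)
        (by positivity) (by rw [show y + s.im - (y + s₀.im) = s.im - s₀.im by ring]; exact him)
      have e1 : y + s.im - T₀ = y - (T₀ - s.im) := by ring
      have e2 : y + s₀.im - T₀ = y - (T₀ - s₀.im) := by ring
      rw [e1, e2] at h
      exact h
    · exact ((integrable_exp_neg_sq_div (c := T₀ - s₀.im) (by positivity)).const_mul _).const_mul _
    · refine ae_of_all _ fun y => ?_
      -- `s ↦ F(s, y)` is continuous on the closed strip `[l, u]`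
      have hcont1 : ContinuousOn (fun s : ℂ => G (s + y * I)) (verticalClosedStrip l u) := by
        refine hG.continuousOn.comp (continuousOn_id.add continuousOn_const) fun s hs => ?_
        obtain ⟨h1, h2⟩ := mem_verticalClosedStrip_iff.1 hs
        exact (add_mul_I_mem_verticalStrip ⟨by linarith, by linarith⟩ y).1
      have hcont2 : ContinuousOn (fun s : ℂ => conj (G (conj s + y * I))) (verticalClosedStrip l u) := by
        refine Complex.continuous_conj.comp_continuousOn ?_
        refine hG.continuousOn.comp ((Complex.continuous_conj.continuousOn).add continuousOn_const) fun s hs => ?_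
        obtain ⟨h1, h2⟩ := mem_verticalClosedStrip_iff.1 hs
        exact (add_mul_I_mem_verticalStrip ⟨by linarith, by linarith⟩ y).2
      exact (hcont1.mul hcont2).mono Set.inter_subset_left
  -- glue
  have hnhds : closedBall s₀ (1 : ℝ) ∈ 𝓝 s₀ := closedBall_mem_nhds s₀ one_pos
  exact (continuousWithinAt_inter hnhds).1 (hpiece s₀ ⟨hs₀, mem_closedBall_self zero_le_one⟩)

/-- **`Φ` is bounded on the closed strip**: `‖Φ(s)‖ ≤ M² V √π`. [folklore] -/
theorem norm_Phi_le (hM : 0 ≤ M) (hV : 0 < V) (hδ : 0 < δ)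
    (hB : ∀ z ∈ verticalClosedStrip (l - δ) (u + δ), ‖G z‖ ≤ M * Real.exp (-(z.im - T₀) ^ 2 / V ^ 2))
    {s : ℂ} (hs : s ∈ verticalClosedStrip l u) :
    ‖∫ y : ℝ, G (s + y * I) * conj (G (conj s + y * I))‖ ≤ M ^ 2 * (V * Real.sqrt π) := by
  obtain ⟨hs1, hs2⟩ := mem_verticalClosedStrip_iff.1 hs
  have hsmem : s ∈ verticalClosedStrip (l - δ) (u + δ) := by
    rw [mem_verticalClosedStrip_iff]; constructor <;> linarith
  refine (norm_integral_le_integral_norm _).trans ?_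
  have hint := (integrable_exp_neg_sq_div (c := T₀ - s.im) (by positivity : (0 : ℝ) < V ^ 2)).const_mul (M ^ 2)
  calc ∫ y : ℝ, ‖G (s + y * I) * conj (G (conj s + y * I))‖
      ≤ ∫ y : ℝ, M ^ 2 * Real.exp (-(y - (T₀ - s.im)) ^ 2 / V ^ 2) := by
        refine integral_mono_of_nonneg (ae_of_all _ fun y => norm_nonneg _) hint
          (ae_of_all _ fun y => norm_family_le hM hB hsmem y)
    _ = M ^ 2 * (V * Real.sqrt π) := by
        rw [integral_const_mul, integral_exp_neg_sq_div (by positivity)]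
        congr 1
        rw [Real.sqrt_mul' _ (sq_nonneg V), Real.sqrt_sq hV.le, mul_comm]

/-- Integrability of `y ↦ |G(a+iy)|²` for `a ∈ [l − δ, u + δ]`. [folklore] -/
theorem integrable_norm_sq_vertical (hV : 0 < V)
    (hG : DifferentiableOn ℂ G (verticalStrip (l - δ) (u + δ)))
    (hB : ∀ z ∈ verticalClosedStrip (l - δ) (u + δ), ‖G z‖ ≤ M * Real.exp (-(z.im - T₀) ^ 2 / V ^ 2))
    {a : ℝ} (ha : l - δ < a ∧ a < u + δ) :
    Integrable fun y : ℝ => ‖G (a + y * I)‖ ^ 2 := by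
  have hcont : Continuous fun y : ℝ => ‖G (a + y * I)‖ ^ 2 :=
    ((continuous_G_vertical hG (s := (a : ℂ)) (by simpa using ha)).norm).pow 2
  have hamem : ∀ y : ℝ, (a : ℂ) + y * I ∈ verticalClosedStrip (l - δ) (u + δ) := fun y => by
    rw [mem_verticalClosedStrip_iff]; simp; constructor <;> linarith
  refine Integrable.mono' ((integrable_exp_neg_sq_div (c := T₀) (by positivity : (0 : ℝ) < V ^ 2)).const_mul (M ^ 2))
    hcont.aestronglyMeasurable (ae_of_all _ fun y => ?_)
  rw [Real.norm_eq_abs, abs_of_nonneg (by positivity)]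
  have h := hB _ (hamem y)
  have him : ((a : ℂ) + y * I).im = y := by simp
  rw [him] at h
  have hle1 : Real.exp (-(y - T₀) ^ 2 / V ^ 2) ≤ 1 := by
    rw [Real.exp_le_one_iff, neg_div]; exact neg_nonpos.2 (by positivity)
  have h0 : 0 ≤ Real.exp (-(y - T₀) ^ 2 / V ^ 2) := (Real.exp_pos _).le
  calc ‖G (a + y * I)‖ ^ 2 ≤ (M * Real.exp (-(y - T₀) ^ 2 / V ^ 2)) ^ 2 := by
        exact pow_le_pow_left₀ (norm_nonneg _) h 2
    _ = M ^ 2 * Real.exp (-(y - T₀) ^ 2 / V ^ 2) * Real.exp (-(y - T₀) ^ 2 / V ^ 2) := by ring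
    _ ≤ M ^ 2 * Real.exp (-(y - T₀) ^ 2 / V ^ 2) * 1 := by gcongr
    _ = _ := mul_one _

/-- **Edge (and interior) bound `‖Φ(s)‖ ≤ J(Re s)`** by `|ab| ≤ (|a|² + |b|²)/2` and translation
invariance of Lebesgue measure. [folklore] -/
theorem norm_Phi_le_meanSquare (hV : 0 < V)
    (hG : DifferentiableOn ℂ G (verticalStrip (l - δ) (u + δ)))
    (hB : ∀ z ∈ verticalClosedStrip (l - δ) (u + δ), ‖G z‖ ≤ M * Real.exp (-(z.im - T₀) ^ 2 / V ^ 2))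
    {s : ℂ} (hs : l - δ < s.re ∧ s.re < u + δ) :
    ‖∫ y : ℝ, G (s + y * I) * conj (G (conj s + y * I))‖ ≤ ∫ y : ℝ, ‖G (s.re + y * I)‖ ^ 2 := by
  have hJ := integrable_norm_sq_vertical hV hG hB hs
  refine (norm_integral_le_integral_norm _).trans ?_
  -- pointwise AM–GM
  have hpt : ∀ y : ℝ, ‖G (s + y * I) * conj (G (conj s + y * I))‖ ≤
      (‖G (s.re + (y + s.im) * I)‖ ^ 2 + ‖G (s.re + (y - s.im) * I)‖ ^ 2) / 2 := by
    intro y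
    have e1 : s + y * I = (s.re : ℂ) + (y + s.im : ℝ) * I := by
      apply Complex.ext
      · simp
      · simp; ring
    have e2 : conj s + y * I = (s.re : ℂ) + (y - s.im : ℝ) * I := by
      apply Complex.ext
      · simp
      · simp; ring
    rw [norm_mul, Complex.norm_conj, e1, e2]
    push_cast
    nlinarith [sq_nonneg (‖G (s.re + (y + s.im) * I)‖ - ‖G (s.re + (y - s.im) * I)‖)]
  have hI1 : Integrable fun y : ℝ => ‖G (s.re + (y + s.im) * I)‖ ^ 2 := by
    have := hJ.comp_add_right s.im
    refine this.congr (ae_of_all _ fun y => ?_)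
    push_cast; ring_nf
  have hI2 : Integrable fun y : ℝ => ‖G (s.re + (y - s.im) * I)‖ ^ 2 := by
    have := hJ.comp_sub_right s.im
    refine this.congr (ae_of_all _ fun y => ?_)
    push_cast; ring_nf
  calc ∫ y : ℝ, ‖G (s + y * I) * conj (G (conj s + y * I))‖
      ≤ ∫ y : ℝ, (‖G (s.re + (y + s.im) * I)‖ ^ 2 + ‖G (s.re + (y - s.im) * I)‖ ^ 2) / 2 :=
        integral_mono_of_nonneg (ae_of_all _ fun y => norm_nonneg _) ((hI1.add hI2).div_const 2)
          (ae_of_all _ hpt)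
    _ = ((∫ y : ℝ, ‖G (s.re + (y + s.im) * I)‖ ^ 2) + ∫ y : ℝ, ‖G (s.re + (y - s.im) * I)‖ ^ 2) / 2 := by
        rw [integral_div, integral_add hI1 hI2]
    _ = ∫ y : ℝ, ‖G (s.re + y * I)‖ ^ 2 := by
        have h1 := integral_add_right_eq_self (μ := volume) (fun y : ℝ => ‖G (s.re + y * I)‖ ^ 2) s.im
        have h2 := integral_sub_right_eq_self (μ := volume) (fun y : ℝ => ‖G (s.re + y * I)‖ ^ 2) s.im
        have e1 : (fun y : ℝ => ‖G (s.re + (y + s.im) * I)‖ ^ 2) = fun y : ℝ => ‖G (s.re + ((y + s.im : ℝ) : ℂ) * I)‖ ^ 2 := by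
          funext y; push_cast; ring_nf
        have e2 : (fun y : ℝ => ‖G (s.re + (y - s.im) * I)‖ ^ 2) = fun y : ℝ => ‖G (s.re + ((y - s.im : ℝ) : ℂ) * I)‖ ^ 2 := by
          funext y; push_cast; ring_nf
        rw [e1, e2, h1, h2]; ring

/-- **`Φ(σ) = J(σ)` for real `σ`.** [folklore] -/
theorem Phi_ofReal (G : ℂ → ℂ) (σ : ℝ) :
    (∫ y : ℝ, G (σ + y * I) * conj (G (conj (σ : ℂ) + y * I))) = ((∫ y : ℝ, ‖G (σ + y * I)‖ ^ 2 : ℝ) : ℂ) := by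
  rw [← integral_complex_ofReal]
  refine integral_congr_ae (ae_of_all _ fun y => ?_)
  simp only [Complex.conj_ofReal]
  rw [Complex.mul_conj, Complex.normSq_eq_norm_sq, Complex.ofReal_pow]

/-- **Convexity of mean squares (Hardy–Ingham–Pólya; Gabriel's theorem in one variable).**
Let `G` be holomorphic on the open strip `l − δ < Re s < u + δ` (`δ > 0`) with
`‖G(s)‖ ≤ M e^{-(Im s − T₀)²/V²}` on its closure (`V > 0`). Then for `l ≤ σ ≤ u`,
`∫ |G(σ+iy)|² dy ≤ (∫ |G(l+iy)|² dy)^{1−θ} (∫ |G(u+iy)|² dy)^θ`, `θ = (σ − l)/(u − l)`.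
[cite: Titchmarsh1986, §7.8] -/
theorem meanSquare_le_interp (hul : l < u) (hδ : 0 < δ) (hV : 0 < V) (hM : 0 ≤ M)
    (hG : DifferentiableOn ℂ G (verticalStrip (l - δ) (u + δ)))
    (hB : ∀ z ∈ verticalClosedStrip (l - δ) (u + δ), ‖G z‖ ≤ M * Real.exp (-(z.im - T₀) ^ 2 / V ^ 2))
    {σ : ℝ} (hσ : l ≤ σ ∧ σ ≤ u) :
    ∫ y : ℝ, ‖G (σ + y * I)‖ ^ 2 ≤
      (∫ y : ℝ, ‖G (l + y * I)‖ ^ 2) ^ (1 - (σ - l) / (u - l)) * (∫ y : ℝ, ‖G (u + y * I)‖ ^ 2) ^ ((σ - l) / (u - l)) := by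
  set Φ : ℂ → ℂ := fun s => ∫ y : ℝ, G (s + y * I) * conj (G (conj s + y * I)) with hΦ
  have hd : DiffContOnCl ℂ Φ (verticalStrip l u) := by
    refine ⟨differentiableOn_Phi hδ hV hM hG hB, ?_⟩
    have hcl : closure (verticalStrip l u) = verticalClosedStrip l u := by
      rw [verticalStrip, verticalClosedStrip, Complex.closure_preimage_re, closure_Ioo hul.ne]
    rw [hcl]
    exact continuousOn_Phi hδ hV hM hG hB
  have hBdd : BddAbove ((norm ∘ Φ) '' verticalClosedStrip l u) := by
    refine ⟨M ^ 2 * (V * Real.sqrt π), ?_⟩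
    rintro _ ⟨s, hs, rfl⟩
    exact norm_Phi_le hM hV hδ hB hs
  have ha : ∀ z ∈ re ⁻¹' {l}, ‖Φ z‖ ≤ ∫ y : ℝ, ‖G (l + y * I)‖ ^ 2 := by
    intro z hz
    have hzre : z.re = l := hz
    have h := norm_Phi_le_meanSquare hV hG hB (s := z) ⟨by linarith, by linarith⟩
    rwa [hzre] at h
  have hb : ∀ z ∈ re ⁻¹' {u}, ‖Φ z‖ ≤ ∫ y : ℝ, ‖G (u + y * I)‖ ^ 2 := by
    intro z hz
    have hzre : z.re = u := hz
    have h := norm_Phi_le_meanSquare hV hG hB (s := z) ⟨by linarith, by linarith⟩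
    rwa [hzre] at h
  have hσmem : (σ : ℂ) ∈ verticalClosedStrip l u := by
    rw [mem_verticalClosedStrip_iff]; simpa using hσ
  have key := Complex.HadamardThreeLines.norm_le_interp_of_mem_verticalClosedStrip' hul hσmem hd hBdd ha hb
  have hΦσ : ‖Φ σ‖ = ∫ y : ℝ, ‖G (σ + y * I)‖ ^ 2 := by
    simp only [hΦ]
    rw [Phi_ofReal, Complex.norm_real, Real.norm_eq_abs, abs_of_nonneg]
    exact integral_nonneg fun y => by positivity
  rw [hΦσ, Complex.ofReal_re] at key
  exact key

end Phi

end Literature.Analysis.Complex
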